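import Mathlib
import Literature.Analysis.ValidatedNumerics.IntervalPolynomial
import HarnessLib

/-!
# Exact exp-polynomial algebra over `ℚ`, I: polynomials as coefficient lists and the antiderivative of `p(x)e^{κx}`

Topic `Literature/Analysis/ValidatedNumerics`: kernel-evaluable data structures with real denotations,
in the style of this directory (`KernelData.lean`, `ExpSumEnclosure.lean`, …).  A polynomial is a
coefficient list `[c₀, c₁, …]` over `ℚ` (`Poly`), evaluated at a real point by Horner's rule
(`Poly.eval`, and exactly at a rational point, `Poly.evalQ`); the file provides `add`, `smul`, `mul`,
the formal derivative `deriv` (with `hasDerivAt_eval`) and — the one non-trivial item — the exact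
ANTIDERIVATIVE `Poly.ad κ p` of `p(x) e^{κx}` with the same rate `κ`: for `κ ≠ 0` the downward
recurrence `d_m = (c_m − (m+1) d_{m+1}) / κ` (integration by parts, `O(deg)` operations), for `κ = 0`
termwise `c_m / (m+1)`; `Poly.hasDerivAt_ad` is its soundness.  Also: power-form evaluation
`evalFrom`, trailing-zero removal `trim`, polynomials in the variable `c₀ − s` (`shift`), and the
constructor `mkPoly` from raw `(numerator, denominator)` data.  Everything is computable over `ℚ`
and all recursions are structural on lists, so closed terms reduce in the kernel (`decide`).

Origin: the package file `Dhl42/ClosedForm/ExpPoly.lean` of the DHL[42,2] certificate (its lines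
28–258, 621–645, 786–807), where these structures carry the exact main terms of a multidimensional
sieve bound (iterated convolutions and definite integrals of exp-polynomials, checked by the kernel
against rational checkpoints); split here into `ExpPoly/Poly.lean` (this file), `ExpPoly/Eval.lean`
(block sums `Σ p(x)e^{κx+θ}`, formal sums, canonical forms) and `ExpPoly/Calculus.lean` (exact
integrals, the convolution step, tail integrals).  The declarations are unchanged but for the
namespace; they state no number theory.

## Main definitions (namespace `Literature.Analysis.ValidatedNumerics.ExpPoly`)

* `Poly := List ℚ`; `Poly.eval p x : ℝ` (Horner), `Poly.evalQ p x : ℚ`; `Poly.add`, `Poly.smul`,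
  `Poly.mul`, `Poly.deriv`; `Poly.evalFrom m p x = x^m · eval p x`.
* `Poly.ad κ p` (via `Poly.adAux`, `Poly.divFrom`) — coefficients of an antiderivative of
  `p(x) e^{κx}` of the form `d(x) e^{κx}`.
* `Poly.trim`, `Poly.shift cs c₀` (`Σ_a cs[a] (c₀ − s)^a` as a polynomial in `s`), `mkPoly`.

## Main results

* `Poly.eval_add`, `Poly.eval_smul`, `Poly.eval_mul`, `Poly.hasDerivAt_eval` — soundness of the algebra.
* `Poly.hasDerivAt_ad : HasDerivAt (fun y ↦ eval (ad κ p) y * exp (κ y + θ)) (eval p x * exp (κ x + θ)) x`.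
* `Poly.eval_evalQ`, `Poly.eval_trim`, `Poly.eval_shift_cons`.
* `Poly.eval_eq_evalR`, `Poly.map_add/map_smul/map_mul/map_deriv`: casting coefficients to `ℝ`
  takes `eval/add/smul/mul/deriv` to `PolyMP.evalR/addR/smulR/mulR/derR` of `IntervalPolynomial.lean`
  (same directory) — those are the noncomputable real SHADOWS of interval polynomials; the present
  lists are their exact-RATIONAL, computable companion (exact `evalQ`; `ad` divides by `κ`; closed
  terms reduce in the kernel), not a second copy of that layer.

NOT here: anything about `Polynomial ℚ` of Mathlib (these are LISTS, chosen for kernel reduction; no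
ring structure is registered; `ListPolynomial.lean`'s `PolyMP.toPoly` relates the real shadows to
`Polynomial ℝ` if ever needed), numerical (interval) evaluation, multivariate polynomials.

## References

* Horner's rule; integration by parts for `∫ x^m e^{κx} dx`; W. Rudin, *Principles of Mathematical
  Analysis*, 3rd ed., Thm 6.21 (fundamental theorem of calculus). [folklore]
-/

open Real

namespace Literature.Analysis.ValidatedNumerics.ExpPoly

/-! ## Polynomials as coefficient lists -/

/-- Coefficient lists `[c₀, c₁, …, c_d]` over `ℚ`. [folklore] -/
abbrev Poly := List ℚ

namespace Poly

/-- Horner evaluation at a real point: `eval [c₀, c₁, …] x = c₀ + x (c₁ + x (…))`. [folklore] -/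
def eval : Poly → ℝ → ℝ
  | [], _ => 0
  | c :: p, x => (c : ℝ) + x * eval p x

/-- Horner evaluation at a rational point (exact). [folklore] -/
def evalQ : Poly → ℚ → ℚ
  | [], _ => 0
  | c :: p, x => c + x * evalQ p x

/-- The empty coefficient list evaluates to `0`. [folklore] -/
@[simp] theorem eval_nil (x : ℝ) : eval [] x = 0 := rfl
/-- Horner step: `eval (c :: p) x = c + x · eval p x`. [folklore] -/
@[simp] theorem eval_cons (c : ℚ) (p : Poly) (x : ℝ) : eval (c :: p) x = c + x * eval p x := rfl

/-- Exact rational evaluation agrees with real evaluation: `(evalQ p x : ℝ) = eval p x`. [folklore]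
-/
theorem eval_evalQ : ∀ (p : Poly) (x : ℚ), ((evalQ p x : ℚ) : ℝ) = eval p x
  | [], _ => by simp [evalQ]
  | c :: p, x => by simp [evalQ, eval_evalQ p x]

/-- The constant coefficient is the value at `0`. [folklore] -/
theorem eval_zero_eq_headD : ∀ (p : Poly), eval p 0 = ((p.headD 0 : ℚ) : ℝ)
  | [] => by simp
  | c :: p => by simp

/-- Coefficientwise sum. [folklore] -/
def add : Poly → Poly → Poly
  | [], q => q
  | p, [] => p
  | a :: p, b :: q => (a + b) :: add p q

/-- `add [] q = q`. [folklore] -/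
@[simp] theorem add_nil_left (q : Poly) : add [] q = q := by cases q <;> rfl
/-- `add p [] = p`. [folklore] -/
@[simp] theorem add_nil_right (p : Poly) : add p [] = p := by cases p <;> rfl
/-- `add` on two non-empty lists adds the heads and recurses on the tails. [folklore] -/
@[simp] theorem add_cons_cons (a b : ℚ) (p q : Poly) :
    add (a :: p) (b :: q) = (a + b) :: add p q := rfl

/-- Soundness of `add`: `eval (add p q) x = eval p x + eval q x`. [folklore] -/
theorem eval_add : ∀ (p q : Poly) (x : ℝ), eval (add p q) x = eval p x + eval q x
  | [], q, x => by simp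
  | a :: p, [], x => by simp
  | a :: p, b :: q, x => by
      simp only [add_cons_cons, eval_cons, eval_add p q x]; push_cast; ring

/-- Scalar multiple. [folklore] -/
def smul (c : ℚ) (p : Poly) : Poly := p.map (fun a => c * a)

/-- `smul c [] = []`. [folklore] -/
@[simp] theorem smul_nil (c : ℚ) : smul c [] = [] := rfl
/-- `smul c (a :: p) = (c·a) :: smul c p`. [folklore] -/
@[simp] theorem smul_cons (c a : ℚ) (p : Poly) : smul c (a :: p) = (c * a) :: smul c p := rfl

/-- Soundness of `smul`: `eval (smul c p) x = c · eval p x`. [folklore] -/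
theorem eval_smul (c : ℚ) : ∀ (p : Poly) (x : ℝ), eval (smul c p) x = c * eval p x
  | [], x => by simp
  | a :: p, x => by simp only [smul_cons, eval_cons, eval_smul c p x]; push_cast; ring

/-- Product (`(a + x p) q = a q + x (p q)`). [folklore] -/
def mul : Poly → Poly → Poly
  | [], _ => []
  | a :: p, q => add (smul a q) (0 :: mul p q)

/-- Soundness of `mul`: `eval (mul p q) x = eval p x · eval q x`. [folklore] -/
theorem eval_mul : ∀ (p q : Poly) (x : ℝ), eval (mul p q) x = eval p x * eval q x
  | [], q, x => by simp [mul]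
  | a :: p, q, x => by
      simp only [mul, eval_add, eval_smul, eval_cons, eval_mul p q x]; push_cast; ring

/-- Formal derivative in Horner form: `(a + x p(x))' = p(x) + x p'(x)`. [folklore] -/
def deriv : Poly → Poly
  | [] => []
  | _ :: p => add p (0 :: deriv p)

/-- `x ↦ eval p x` is continuous (a polynomial function). [folklore] -/
theorem continuous_eval : ∀ (p : Poly), Continuous (eval p)
  | [] => by
      show Continuous (fun _ : ℝ => (0 : ℝ))
      exact continuous_const
  | c :: p => by
      show Continuous (fun x : ℝ => (c : ℝ) + x * eval p x)
      exact continuous_const.add (continuous_id.mul (continuous_eval p))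

/-- Soundness of the formal derivative: `eval p` has derivative `eval (deriv p) x` at every real
`x`. [folklore] -/
theorem hasDerivAt_eval : ∀ (p : Poly) (x : ℝ), HasDerivAt (eval p) (eval (deriv p) x) x
  | [], x => by
      show HasDerivAt (fun _ : ℝ => (0 : ℝ)) (eval [] x) x
      rw [eval_nil]
      exact hasDerivAt_const x (0 : ℝ)
  | c :: p, x => by
      have h1 := hasDerivAt_eval p x
      have h2 : HasDerivAt (fun y => y * eval p y) (1 * eval p x + x * eval (deriv p) x) x :=
        (hasDerivAt_id x).mul h1
      have h3 : HasDerivAt (fun y => (c : ℝ) + y * eval p y)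
          (1 * eval p x + x * eval (deriv p) x) x := h2.const_add _
      show HasDerivAt (fun y => (c : ℝ) + y * eval p y) (eval (deriv (c :: p)) x) x
      refine h3.congr_deriv ?_
      show 1 * eval p x + x * eval (deriv p) x = eval (add p (0 :: deriv p)) x
      rw [eval_add, eval_cons]; push_cast; ring

/-! ### Power-form evaluation (for the antiderivative recurrence) -/

/-- `evalFrom m [d₀, d₁, …] x = Σᵢ dᵢ x^{m+i}`. [folklore] -/
def evalFrom : ℕ → Poly → ℝ → ℝ
  | _, [], _ => 0
  | m, d :: ds, x => (d : ℝ) * x ^ m + evalFrom (m + 1) ds x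

/-- `evalFrom m [] x = 0`. [folklore] -/
@[simp] theorem evalFrom_nil (m : ℕ) (x : ℝ) : evalFrom m [] x = 0 := rfl
/-- `evalFrom m (d :: ds) x = d·x^m + evalFrom (m+1) ds x`. [folklore] -/
@[simp] theorem evalFrom_cons (m : ℕ) (d : ℚ) (ds : Poly) (x : ℝ) :
    evalFrom m (d :: ds) x = d * x ^ m + evalFrom (m + 1) ds x := rfl

/-- Power form versus Horner form: `evalFrom m p x = x^m · eval p x`. [folklore] -/
theorem evalFrom_eq : ∀ (m : ℕ) (p : Poly) (x : ℝ), evalFrom m p x = x ^ m * eval p x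
  | m, [], x => by simp
  | m, d :: ds, x => by
      simp only [evalFrom_cons, eval_cons, evalFrom_eq (m + 1) ds x, pow_succ]; ring

/-- `eval p x = evalFrom 0 p x`. [folklore] -/
theorem eval_eq_evalFrom (p : Poly) (x : ℝ) : eval p x = evalFrom 0 p x := by
  simp [evalFrom_eq]

/-! ### Antiderivative of `p(x) e^{κ x}` -/

/-- `κ ≠ 0`: coefficients `d` with `(d(x) e^{κx})' = p(x) e^{κx}`, by the downward recurrence
`d_m = (c_m − (m+1) d_{m+1}) / κ`; the head of the input has index `m`. [folklore] -/
def adAux (κ : ℚ) : ℕ → Poly → Poly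
  | _, [] => []
  | m, c :: cs =>
      let d := adAux κ (m + 1) cs
      ((c - (m + 1) * d.headD 0) / κ) :: d

/-- `κ = 0`: `∫ Σ cᵢ x^{m+i-1} = Σ cᵢ/(m+i) x^{m+i}` — the head of the input gets exponent `m`.
[folklore] -/
def divFrom : ℕ → Poly → Poly
  | _, [] => []
  | m, c :: cs => (c / m) :: divFrom (m + 1) cs

/-- Coefficients of an antiderivative `d(x) e^{κx}` of `p(x) e^{κx}` (same rate `κ`). [folklore] -/
def ad (κ : ℚ) (p : Poly) : Poly := if κ = 0 then 0 :: divFrom 1 p else adAux κ 0 p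

/-- Soundness of `divFrom` (the case `κ = 0`): `y ↦ Σᵢ cᵢ/(m+1+i) · y^{m+1+i}` has derivative
`Σᵢ cᵢ x^{m+i}` at `x` (termwise power rule). [folklore] -/
theorem hasDerivAt_divFrom :
    ∀ (m : ℕ) (cs : Poly) (x : ℝ),
      HasDerivAt (fun y => evalFrom (m + 1) (divFrom (m + 1) cs) y) (evalFrom m cs x) x
  | m, [], x => by
      show HasDerivAt (fun _ : ℝ => (0 : ℝ)) (evalFrom m [] x) x
      rw [evalFrom_nil]
      exact hasDerivAt_const x (0 : ℝ)
  | m, c :: cs, x => by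
      have ih := hasDerivAt_divFrom (m + 1) cs x
      have hpow : HasDerivAt (fun y : ℝ => y ^ (m + 1)) (((m + 1 : ℕ) : ℝ) * x ^ (m + 1 - 1)) x :=
        hasDerivAt_pow (m + 1) x
      have h1 := hpow.const_mul (((c / ((m + 1 : ℕ) : ℚ) : ℚ) : ℝ))
      have h2 := h1.add ih
      show HasDerivAt (fun y => (((c / ((m + 1 : ℕ) : ℚ) : ℚ) : ℝ)) * y ^ (m + 1) +
          evalFrom (m + 1 + 1) (divFrom (m + 1 + 1) cs) y) (evalFrom m (c :: cs) x) x
      refine h2.congr_deriv ?_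
      rw [evalFrom_cons, Nat.add_sub_cancel]
      have hc : (((c / ((m + 1 : ℕ) : ℚ) : ℚ) : ℝ)) * (((m + 1 : ℕ) : ℝ)) = (c : ℝ) := by
        have hm : (((m + 1 : ℕ) : ℚ) : ℝ) ≠ 0 := by positivity
        rw [Rat.cast_div, div_mul_eq_mul_div, ← Rat.cast_natCast, mul_div_assoc, div_self hm, mul_one]
      rw [← mul_assoc, hc]

/-- The derivative of a block in power form, general start index `m` (the `x^{m-1}` term is the
part of `(d₀ x^m)'` that falls below index `m`; it vanishes for `m = 0`). [folklore] -/
theorem hasDerivAt_adAux (κ : ℚ) (hκ : κ ≠ 0) (θ : ℚ) :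
    ∀ (m : ℕ) (cs : Poly) (x : ℝ),
      HasDerivAt (fun y => evalFrom m (adAux κ m cs) y * exp ((κ : ℝ) * y + θ))
        ((evalFrom m cs x + m * ((adAux κ m cs).headD 0 : ℚ) * x ^ (m - 1)) *
          exp ((κ : ℝ) * x + θ)) x
  | m, [], x => by
      show HasDerivAt (fun _ : ℝ => (0 : ℝ) * exp ((κ : ℝ) * _ + θ)) _ x
      have : (evalFrom m [] x + m * ((adAux κ m []).headD 0 : ℚ) * x ^ (m - 1)) *
          exp ((κ : ℝ) * x + θ) = 0 := by simp [adAux]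
      rw [this]
      have h0 : (fun y : ℝ => (0 : ℝ) * exp ((κ : ℝ) * y + θ)) = fun _ => 0 := by funext y; simp
      rw [h0]
      exact hasDerivAt_const x (0 : ℝ)
  | m, c :: cs, x => by
      -- notation: d' = tail coefficients, d0 = head coefficient
      set d' := adAux κ (m + 1) cs with hd'
      set d0 : ℚ := (c - (m + 1) * d'.headD 0) / κ with hd0
      have hunfold : adAux κ m (c :: cs) = d0 :: d' := rfl
      have ih := hasDerivAt_adAux κ hκ θ (m + 1) cs x
      rw [← hd'] at ih
      -- derivative of the exponential factor
      have hlin : HasDerivAt (fun y : ℝ => (κ : ℝ) * y + θ) ((κ : ℝ) * 1) x :=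
        ((hasDerivAt_id x).const_mul (κ : ℝ)).add_const _
      have hexp : HasDerivAt (fun y => exp ((κ : ℝ) * y + θ)) (exp ((κ : ℝ) * x + θ) * ((κ : ℝ) * 1)) x :=
        (Real.hasDerivAt_exp _).comp x hlin
      -- derivative of the head term d0 x^m e^{κx+θ}
      have hpow : HasDerivAt (fun y : ℝ => y ^ m) ((m : ℝ) * x ^ (m - 1)) x := hasDerivAt_pow m x
      have hhead := (hpow.const_mul ((d0 : ℚ) : ℝ)).mul hexp
      have hsum := hhead.add ih
      rw [hunfold]
      show HasDerivAt (fun y => evalFrom m (d0 :: d') y * exp ((κ : ℝ) * y + θ)) _ x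
      have hfun : (fun y => evalFrom m (d0 :: d') y * exp ((κ : ℝ) * y + θ)) =
          fun y => ((d0 : ℚ) : ℝ) * y ^ m * exp ((κ : ℝ) * y + θ) +
            evalFrom (m + 1) d' y * exp ((κ : ℝ) * y + θ) := by
        funext y; rw [evalFrom_cons]; ring
      rw [hfun]
      refine hsum.congr_deriv ?_
      simp only [List.headD_cons, evalFrom_cons, Nat.cast_add, Nat.cast_one, Nat.add_sub_cancel]
      -- κ d0 = c - (m+1) d'₀
      have hkey : (κ : ℝ) * ((d0 : ℚ) : ℝ) = (c : ℝ) - ((m : ℝ) + 1) * ((d'.headD 0 : ℚ) : ℝ) := by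
        rw [hd0]
        have hκ' : (κ : ℝ) ≠ 0 := by exact_mod_cast hκ
        push_cast
        field_simp
      set E := exp ((κ : ℝ) * x + θ)
      linear_combination (x ^ m * E) * hkey

/-- Soundness of the antiderivative `ad`: for all rational `κ, θ` and every `p`,
`y ↦ (ad κ p)(y) · e^{κy+θ}` has derivative `p(x) · e^{κx+θ}` at every real `x` (both cases `κ = 0`,
`κ ≠ 0`). This is the lemma every exact integral below rests on. [folklore] -/
theorem hasDerivAt_ad (κ θ : ℚ) (p : Poly) (x : ℝ) :
    HasDerivAt (fun y => eval (ad κ p) y * exp ((κ : ℝ) * y + θ))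
      (eval p x * exp ((κ : ℝ) * x + θ)) x := by
  unfold ad
  split_ifs with hκ
  · -- κ = 0 : the exponential factor is the constant e^θ
    subst hκ
    have h := (hasDerivAt_divFrom 0 p x).mul_const (exp ((θ : ℚ) : ℝ))
    have hfun : (fun y => eval ((0 : ℚ) :: divFrom 1 p) y * exp ((((0 : ℚ) : ℚ) : ℝ) * y + θ)) =
        fun y => evalFrom 1 (divFrom 1 p) y * exp ((θ : ℚ) : ℝ) := by
      funext y
      rw [eval_cons, evalFrom_eq]
      push_cast
      ring_nf
    rw [hfun]
    refine h.congr_deriv ?_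
    rw [evalFrom_eq]; push_cast; ring_nf
  · have h := hasDerivAt_adAux κ hκ θ 0 p x
    have hfun : (fun y => eval (adAux κ 0 p) y * exp ((κ : ℝ) * y + θ)) =
        fun y => evalFrom 0 (adAux κ 0 p) y * exp ((κ : ℝ) * y + θ) := by
      funext y; rw [eval_eq_evalFrom]
    rw [hfun]
    refine h.congr_deriv ?_
    rw [eval_eq_evalFrom]; push_cast; ring

end Poly

/-! ### Trailing zero coefficients (for the canonical form of `ExpPoly/Eval.lean`) -/

namespace Poly

/-- Remove trailing zero coefficients. [folklore] -/
def trim : Poly → Poly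
  | [] => []
  | c :: p => match trim p with
    | [] => if c = 0 then [] else [c]
    | d :: q => c :: d :: q

/-- Removing trailing zero coefficients does not change the polynomial function. [folklore] -/
theorem eval_trim : ∀ (p : Poly) (x : ℝ), eval (trim p) x = eval p x
  | [], x => rfl
  | c :: p, x => by
      have ih := eval_trim p x
      unfold trim
      split
      · rename_i h
        rw [h] at ih
        split_ifs with hc
        · simp [← ih, hc]
        · simp [← ih]
      · rename_i d q h
        rw [h] at ih
        simp [ih]

end Poly

/-! ## Polynomials in `(c₀ − s)` and raw integer data -/

namespace Poly

/-- `Σ_a cs[a] (c₀ − s)^a` as a `Poly` in `s` (Horner in `c₀ − s`). [folklore] -/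
def shift (cs : List ℚ) (c0 : ℚ) : Poly :=
  cs.foldr (fun c acc => add [c] (mul [c0, -1] acc)) []

/-- `shift [] c₀` is the zero polynomial. [folklore] -/
theorem eval_shift_nil (c0 : ℚ) (s : ℝ) : eval (shift [] c0) s = 0 := rfl

/-- Horner step in the variable `c₀ − s`:
`eval (shift (c :: cs) c₀) s = c + (c₀ − s) · eval (shift cs c₀) s`. [folklore] -/
theorem eval_shift_cons (c : ℚ) (cs : List ℚ) (c0 : ℚ) (s : ℝ) :
    eval (shift (c :: cs) c0) s = c + ((c0 : ℝ) - s) * eval (shift cs c0) s := by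
  show eval (add [c] (mul [c0, -1] (shift cs c0))) s = _
  rw [eval_add, eval_mul]
  simp only [eval_cons, eval_nil]
  push_cast; ring

end Poly

/-- A polynomial from raw `(numerator, denominator)` data. [folklore] -/
def mkPoly (L : List (ℤ × ℕ)) : Poly := L.map fun nd => mkRat nd.1 nd.2

/-! ## Relation to the real coefficient lists `PolyMP.evalR` of `IntervalPolynomial.lean` -/

namespace Poly
/-- `Poly.eval p` is `PolyMP.evalR` (`IntervalPolynomial.lean`) of the list cast to `ℝ`. [folklore] -/
theorem eval_eq_evalR : ∀ (p : Poly) (x : ℝ), eval p x = PolyMP.evalR (p.map ((↑) : ℚ → ℝ)) x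
  | [], _ => rfl
  | c :: p, x => by simp [eval_eq_evalR p x]
/-- Casting coefficients to `ℝ` takes `Poly.add` to `PolyMP.addR`. [folklore] -/
theorem map_add : ∀ (p q : Poly),
    (add p q).map ((↑) : ℚ → ℝ) = PolyMP.addR (p.map (↑)) (q.map (↑))
  | [], q => by simp [PolyMP.addR]
  | a :: p, [] => by simp [PolyMP.addR]
  | a :: p, b :: q => by simp [PolyMP.addR, map_add p q]
/-- Casting coefficients to `ℝ` takes `Poly.smul c` to `PolyMP.smulR ↑c`. [folklore] -/
theorem map_smul (c : ℚ) (p : Poly) :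
    (smul c p).map ((↑) : ℚ → ℝ) = PolyMP.smulR (c : ℝ) (p.map (↑)) := by
  simp [smul, PolyMP.smulR, List.map_map, Function.comp_def]
/-- Casting coefficients to `ℝ` takes `Poly.mul` to `PolyMP.mulR`. [folklore] -/
theorem map_mul : ∀ (p q : Poly),
    (mul p q).map ((↑) : ℚ → ℝ) = PolyMP.mulR (p.map (↑)) (q.map (↑))
  | [], q => by simp [mul, PolyMP.mulR]
  | a :: p, q => by
      simp only [mul, PolyMP.mulR, map_add, map_smul, List.map_cons, Rat.cast_zero, map_mul p q]
/-- Casting coefficients to `ℝ` takes the formal derivative `Poly.deriv` to `PolyMP.derR`. [folklore] -/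
theorem map_deriv : ∀ (p : Poly), (deriv p).map ((↑) : ℚ → ℝ) = PolyMP.derR (p.map (↑))
  | [] => by simp [deriv, PolyMP.derR]
  | a :: p => by
      simp only [deriv, PolyMP.derR, map_add, List.map_cons, Rat.cast_zero, map_deriv p]
end Poly

end Literature.Analysis.ValidatedNumerics.ExpPoly
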